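import Literature.NumberTheory.EllipticCurves.Rank1Residual.Typed.Basic
import HarnessLib

/-!
# The twist-transport COMPARISON STATEMENT (cell `b2b-bsdres`, team n1011, route (c), item T-c1)

HONEST FRAMING (cell `b2b-bsdres`, run/shared/lean/b2b/bsd-rank1-residual/, verbatim in every
file): the goal of the cell is to DELETE the COMBINATION-SHAPED residual classes of the
Birch–Swinnerton-Dyer formula for ALL analytic-rank `≤ 1` elliptic curves over `ℚ` — "full BSD
formula for every rank `≤ 1` curve in class `C`" assembled STRICTLY from published theorems — so
that the rank-`≤ 1` remainder becomes exactly the CONSTRUCTION-SHAPED classes, which are TYPED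
(missing-input `Prop`s), NOT attempted. This is not "finishing BSD". Team n1011 (N10 / N11): prove
what is provable now; shrink each hard class to its core with data; no claim beyond stated classes;
research routes; census output = EVIDENCE / conjecture items, never a Literature fact.

Layer A (this file; Layer B = the twist-pair INSTANCE is the sibling file
`QuadraticTwistBSDComparisonTwistPair.lean`): the class-agnostic bookkeeping behind every row of the E3
RELATIONS table of CLASS-CLOSURE-PLAN §1 item 5 ("open pair ↔ closed pair, relation type, the
comparison statement needed: 'BSD_p(E) ⟺ BSD_p(E^D) given ord_p of the … ratio'"). For two
elliptic curves `W`, `V` over `ℚ` and a prime `p` put, in Miller's currency (`shaAn`, `BSDp`,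
Miller 2011 Def. 1.1), `δ_p(X) := ord_p #Ш_an(X) − ord_p #Ш(X)`. The COMPARISON STATEMENT at `p` is
`DefectAgreeAt W V p : δ_p(W) = δ_p(V)`. Then (`bsdp_iff_bsdp_of_defectAgreeAt`) in analytic rank
`≤ 1` on both sides (Gross–Zagier–Kolyvagin `hGZK`): `BSDp W p ↔ BSDp V p`; conversely
(`defectAgreeAt_of_bsdp_of_bsdp`) two BSD-true pairs always compare, so the comparison statement is
exactly the BSD-consistency of the pair — it is NEVER a theorem "for free". In analytic rank `0` on
both sides, with `L(X,1) = s_X · Ω(X)`, `s_X ∈ ℚ` (modular symbols), the statement unfolds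
(`defectAgreeAt_iff_shaIndex_rankZero`) into the RELATIONS-table columns
`ord_p #Ш(W) − ord_p #Ш(V) = (ord_p s_W − ord_p s_V) + 2 (ord_p #W(ℚ)_tors − ord_p #V(ℚ)_tors)
 − (ord_p ∏c(W) − ord_p ∏c(V))`: three computable columns and ONE arithmetic column (the `Ш`-index),
which is the non-computable input; one-sided readings give `MissingLowerBoundAt W p` /
`MissingUpperBoundAt W p` from `BSDp V p` and the corresponding INEQUALITY on the `Ш`-column.

HONESTY (REFEREE-1 R4; CLASS-CLOSURE-PLAN §3.1 E3 note, reproduced): for the quadratic-twist pair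
at an additive prime (`W = C • V^{(p*)}`, `V` semistable at `p`; Layer B, sibling file) `s_W` and `s_V` are
the values of `V`'s modular-symbol measure at the DIFFERENT characters `χ_{p*}` and `1`; no theorem
relates their `p`-adic valuations, so a CLOSED `(V, p)` does NOT close `(W, p)`. What the kernel
transports along the twist is the UPPER half only, and not from `BSDp V p` but from Kato's
divisibility for `V` read on the `χ_{p*}`-branch (`X4RankZeroTwistOdd.missingUpperBoundAt`,
`X3RankZeroTwistOdd.*`, lines V9/V9b; twist-free: `X4RankZero.missingUpperBoundAt_of_katoSharp`,
Kato 2004 Thm. 14.5 (3)). A LOWER-half transport would be the main conjecture for `V` on the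
`ω^{(p−1)/2}`-branch (Delbourgo 1998 'Main Conjecture' p. 151) — not in print (Skinner–Urban 2014
Thm. 3.6.4: trivial tame character, (ram), `p ∤ N`; Wan 2015: `p` unramified) — it is N10's typed
`MissingLowerBoundAt W p` and is NOT claimed here. This file moves no mark and closes no pair.

Theorems + one bookkeeping `def` (a `Prop` on `(W, V, p)`, nothing asserted); no named fact beyond
the explicit binders `hGZK` (bsd.S17) and `hmod` (modularity).

References: Miller 2011 [Miller2011LMS] Def. 1.1; Darmon 2004 [Darmon2004] Thm. 3.22 (GZK);
Mazur–Tate–Teitelbaum 1986 [MazurTateTeitelbaum1986Invent] §I.8; Pal 2012 [Pal2012] Thm. 3.2;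
Delbourgo 1998 [Delbourgo1998] p. 151; Skinner–Urban 2014 [SkinnerUrban2014] Thm. 3.6.4.
-/

noncomputable section

open scoped Classical

open WeierstrassCurve Literature.NumberTheory.EllipticCurves
  Literature.NumberTheory.EllipticCurves.Rank1Residual
  Literature.NumberTheory.EllipticCurves.Rank1Residual.Typed

namespace Summit.BirchSwinnertonDyer.Rank1Residual.Additive

namespace TwistComparison

/-! ## Layer A — the comparison statement and its bookkeeping (class-agnostic) -/

/-- **The comparison statement at `p` for a pair of curves** (CLASS-CLOSURE-PLAN §1 item 5): the
`p`-adic BSD defects agree, `δ_p(W) = δ_p(V)` where `δ_p(X) := ord_p #Ш_an(X) − ord_p #Ш(X)` with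
`#Ш_an(X) = shaAn X` a rational number (Miller 2011 Def. 1.1 currency; `X` globally minimal for
`shaAn` to be Miller's `#Ш_an`). A predicate on `(W, V, p)`; nothing asserted. BSD predicts
`δ_p = 0` on both sides; the statement is strictly weaker than `BSDp W p ∧ BSDp V p` and strictly
stronger than nothing: it is what makes `BSDp` TRANSPORTABLE across the pair
(`bsdp_iff_bsdp_of_defectAgreeAt`). [folklore] [cite: Miller2011LMS, Def. 1.1 (arXiv:1010.2431 p. 3)] -/
def DefectAgreeAt (W V : WeierstrassCurve ℚ) (p : ℕ) : Prop :=
  ∃ q q' : ℚ, shaAn W = (q : ℂ) ∧ shaAn V = (q' : ℂ) ∧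
    padicValRat p q - (padicValNat p W.shaOrder : ℤ) =
      padicValRat p q' - (padicValNat p V.shaOrder : ℤ)

variable (W V : WeierstrassCurve ℚ) (p : ℕ)

/-- Unfolding of `DefectAgreeAt` (by definition). [folklore] -/
theorem defectAgreeAt_iff : DefectAgreeAt W V p ↔
    ∃ q q' : ℚ, shaAn W = (q : ℂ) ∧ shaAn V = (q' : ℂ) ∧
      padicValRat p q - (padicValNat p W.shaOrder : ℤ) =
        padicValRat p q' - (padicValNat p V.shaOrder : ℤ) := Iff.rfl

/-- The comparison statement is symmetric in the pair. [folklore] -/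
theorem defectAgreeAt_comm : DefectAgreeAt W V p ↔ DefectAgreeAt V W p := by
  constructor
  · rintro ⟨q, q', hq, hq', h⟩
    exact ⟨q', q, hq', hq, h.symm⟩
  · rintro ⟨q', q, hq', hq, h⟩
    exact ⟨q, q', hq, hq', h.symm⟩

/-- The comparison statement is reflexive as soon as `#Ш_an` is rational. [folklore] -/
theorem defectAgreeAt_self {q : ℚ} (hq : shaAn W = (q : ℂ)) : DefectAgreeAt W W p :=
  ⟨q, q, hq, hq, rfl⟩

/-- The comparison statement is transitive (chains of twist / isogeny links compose). [folklore] -/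
theorem defectAgreeAt_trans {U : WeierstrassCurve ℚ} (h₁ : DefectAgreeAt W V p)
    (h₂ : DefectAgreeAt V U p) : DefectAgreeAt W U p := by
  obtain ⟨q, q', hq, hq', h⟩ := h₁
  obtain ⟨r, r', hr, hr', h'⟩ := h₂
  have hrq : r = q' := by exact_mod_cast hr.symm.trans hq'
  subst hrq
  exact ⟨q, r', hq, hr', h.trans h'⟩

/-- With the (unique) rationals `#Ш_an(W) = qW`, `#Ш_an(V) = qV` in hand, the comparison statement
reads `ord_p qW − ord_p #Ш(W) = ord_p qV − ord_p #Ш(V)`. [folklore] -/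
theorem defectAgreeAt_iff_of_shaAn_eq {qW qV : ℚ} (hW : shaAn W = (qW : ℂ))
    (hV : shaAn V = (qV : ℂ)) : DefectAgreeAt W V p ↔
      padicValRat p qW - (padicValNat p W.shaOrder : ℤ) =
        padicValRat p qV - (padicValNat p V.shaOrder : ℤ) := by
  constructor
  · rintro ⟨q, q', hq, hq', h⟩
    have h1 : q = qW := by exact_mod_cast hq.symm.trans hW
    have h2 : q' = qV := by exact_mod_cast hq'.symm.trans hV
    subst h1 h2
    exact h
  · intro h
    exact ⟨qW, qV, hW, hV, h⟩

section Transport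

variable [W.IsElliptic] [V.IsElliptic] [Fact p.Prime]

/-- **Transport of `BSD(E,p)` across a comparing pair, analytic rank `≤ 1` on both sides.** Granted
Gross–Zagier–Kolyvagin (`hGZK` = bsd.S17: `rank = r_an` and `Ш` finite when `r_an ≤ 1`) for `W` and
`V`, the comparison statement `δ_p(W) = δ_p(V)` gives `BSDp W p ↔ BSDp V p`: clauses (i)–(ii) of
Miller's `BSD(·,p)` hold on both sides, clause (iii) is part of `DefectAgreeAt`, and clause (iv)
`ord_p #Ш_an = ord_p #Ш(p) = ord_p #Ш` (`padicValNat_card_addPrimaryComponent`, `Ш` finite) is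
`δ_p = 0`, which transports along `δ_p(W) = δ_p(V)`. Bookkeeping; class-agnostic (any two curves).
[cite: Miller2011LMS, Def. 1.1] [cite: Darmon2004, Thm. 3.22] -/
theorem bsdp_iff_bsdp_of_defectAgreeAt (hGZK : rank_eq_analyticRank_of_analyticRank_le_one)
    (hrW : W.analyticRank ≤ 1) (hrV : V.analyticRank ≤ 1) (h : DefectAgreeAt W V p) :
    BSDp W p ↔ BSDp V p := by
  obtain ⟨hrkW, hfinW⟩ := hGZK W hrW
  obtain ⟨hrkV, hfinV⟩ := hGZK V hrV
  haveI : Finite W.sha := hfinW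
  haveI : Finite V.sha := hfinV
  obtain ⟨q, q', hq, hq', hδ⟩ := h
  have hW' : padicValNat p (Nat.card (AddCommGroup.primaryComponent W.sha p)) =
      padicValNat p W.shaOrder := by
    rw [WeierstrassCurve.shaOrder, padicValNat_card_addPrimaryComponent]
  have hV' : padicValNat p (Nat.card (AddCommGroup.primaryComponent V.sha p)) =
      padicValNat p V.shaOrder := by
    rw [WeierstrassCurve.shaOrder, padicValNat_card_addPrimaryComponent]
  constructor
  · rintro ⟨-, -, r, hr, hrv⟩
    have hrq : r = q := by exact_mod_cast hr.symm.trans hq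
    subst hrq
    refine ⟨hrkV, Finite.of_injective _ Subtype.val_injective, q', hq', ?_⟩
    rw [hV']
    rw [hW'] at hrv
    omega
  · rintro ⟨-, -, r, hr, hrv⟩
    have hrq : r = q' := by exact_mod_cast hr.symm.trans hq'
    subst hrq
    refine ⟨hrkW, Finite.of_injective _ Subtype.val_injective, q, hq, ?_⟩
    rw [hW']
    rw [hV'] at hrv
    omega

omit [W.IsElliptic] [V.IsElliptic] in
/-- **Necessity.** Two pairs for which `BSD(·,p)` holds (with `Ш` finite, so that
`ord_p #Ш(p) = ord_p #Ш`) always compare: `δ_p(W) = 0 = δ_p(V)`. So the comparison statement is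
exactly the BSD-consistency of the pair; it is never available "for free".
[cite: Miller2011LMS, Def. 1.1] -/
theorem defectAgreeAt_of_bsdp_of_bsdp [Finite W.sha] [Finite V.sha] (hW : BSDp W p)
    (hV : BSDp V p) : DefectAgreeAt W V p := by
  obtain ⟨-, -, q, hq, hqv⟩ := hW
  obtain ⟨-, -, q', hq', hqv'⟩ := hV
  refine ⟨q, q', hq, hq', ?_⟩
  rw [hqv, hqv', WeierstrassCurve.shaOrder, WeierstrassCurve.shaOrder,
    padicValNat_card_addPrimaryComponent, padicValNat_card_addPrimaryComponent]
  simp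

omit [W.IsElliptic] [V.IsElliptic] in
/-- One-sided transport, LOWER half: if `BSD(V,p)` holds and `δ_p(W) ≤ δ_p(V)` — i.e. with the
rationals `qW = #Ш_an(W)`, `qV = #Ш_an(V)`: `ord_p qW − ord_p #Ш(W) ≤ ord_p qV − ord_p #Ш(V)` — then
`MissingLowerBoundAt W p` (`ord_p #Ш_an(W) ≤ ord_p #Ш(W)`). Bookkeeping.
[cite: Miller2011LMS, Def. 1.1] -/
theorem missingLowerBoundAt_of_bsdp_of_defect_le [Finite V.sha] (hV : BSDp V p) {qW qV : ℚ}
    (hW : shaAn W = (qW : ℂ)) (hqV : shaAn V = (qV : ℂ))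
    (hle : padicValRat p qW - (padicValNat p W.shaOrder : ℤ) ≤
      padicValRat p qV - (padicValNat p V.shaOrder : ℤ)) : MissingLowerBoundAt W p := by
  obtain ⟨-, -, q', hq', hqv'⟩ := hV
  have h2 : q' = qV := by exact_mod_cast hq'.symm.trans hqV
  subst h2
  have hv0 : padicValRat p q' = (padicValNat p V.shaOrder : ℤ) := by
    rw [hqv', WeierstrassCurve.shaOrder, padicValNat_card_addPrimaryComponent]
  rw [hv0, sub_self] at hle
  exact ⟨qW, hW, by omega⟩

omit [W.IsElliptic] [V.IsElliptic] in
/-- One-sided transport, UPPER half: if `BSD(V,p)` holds and `δ_p(V) ≤ δ_p(W)`, then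
`MissingUpperBoundAt W p` (`ord_p #Ш(W) ≤ ord_p #Ш_an(W)`). Bookkeeping.
[cite: Miller2011LMS, Def. 1.1] -/
theorem missingUpperBoundAt_of_bsdp_of_defect_ge [Finite V.sha] (hV : BSDp V p) {qW qV : ℚ}
    (hW : shaAn W = (qW : ℂ)) (hqV : shaAn V = (qV : ℂ))
    (hge : padicValRat p qV - (padicValNat p V.shaOrder : ℤ) ≤
      padicValRat p qW - (padicValNat p W.shaOrder : ℤ)) : MissingUpperBoundAt W p := by
  obtain ⟨-, -, q', hq', hqv'⟩ := hV
  have h2 : q' = qV := by exact_mod_cast hq'.symm.trans hqV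
  subst h2
  have hv0 : padicValRat p q' = (padicValNat p V.shaOrder : ℤ) := by
    rw [hqv', WeierstrassCurve.shaOrder, padicValNat_card_addPrimaryComponent]
  rw [hv0, sub_self] at hge
  exact ⟨qW, hW, by omega⟩

end Transport

/-! ## Layer A, rank `0`: the comparison statement in RELATIONS-table columns -/

section RankZero

variable [W.IsElliptic] [Fact p.Prime]

/-- In analytic rank `0`, with `L(W,1) = s · Ω(W)` (`s ∈ ℚ`; `Ω = realPeriodRat`, the BSD period
for a globally minimal model), `#Ш_an(W)` is the rational number `s · #W(ℚ)_tors² / ∏_ℓ c_ℓ(W)`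
(`Reg = 1` by `rank = r_an = 0`, GZK). Bookkeeping from `shaAn_def`.
[cite: Miller2011LMS, §1 (arXiv:1010.2431 p. 3)] [cite: Darmon2004, Thm. 3.22] -/
theorem shaAn_eq_ratCast_of_rankZero (hGZK : rank_eq_analyticRank_of_analyticRank_le_one)
    (hr : W.analyticRank = 0) {s : ℚ}
    (hs : W.entireLFunction 1 = (s : ℂ) * (W.realPeriodRat : ℂ)) :
    shaAn W = ((s * (W.torsionOrder : ℚ) ^ 2 / (W.tamagawaProduct : ℚ) : ℚ) : ℂ) := by
  have hrank : W.mordellWeilRank = 0 := by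
    have := (hGZK W (by omega)).1
    omega
  have hΩ : (W.realPeriodRat : ℂ) ≠ 0 := by exact_mod_cast W.realPeriodRat_pos_holds.ne'
  have hc : (W.tamagawaProduct : ℂ) ≠ 0 := by exact_mod_cast W.tamagawaProduct_pos_holds.ne'
  rw [shaAn_def, leadingLCoeff_eq_of_analyticRank_eq_zero W hr, hs,
    W.regulator_eq_one_of_rank_zero hrank]
  push_cast
  field_simp

omit [W.IsElliptic] in
/-- Valuation of the rank-`0` rational `s · #tors² / ∏ c`:
`ord_p = ord_p s + 2 ord_p #W(ℚ)_tors − ord_p ∏_ℓ c_ℓ(W)` (for `s ≠ 0`). Bookkeeping.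
[cite: Miller2011LMS, §1] -/
theorem padicValRat_shaAnRat_of_rankZero {s : ℚ} (hs0 : s ≠ 0) (ht : 0 < W.torsionOrder)
    (hc : 0 < W.tamagawaProduct) :
    padicValRat p (s * (W.torsionOrder : ℚ) ^ 2 / (W.tamagawaProduct : ℚ)) =
      padicValRat p s + 2 * (padicValNat p W.torsionOrder : ℤ) -
        (padicValNat p W.tamagawaProduct : ℤ) := by
  have ht' : (W.torsionOrder : ℚ) ≠ 0 := by exact_mod_cast ht.ne'
  have hc' : (W.tamagawaProduct : ℚ) ≠ 0 := by exact_mod_cast hc.ne'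
  rw [padicValRat.div (mul_ne_zero hs0 (pow_ne_zero 2 ht')) hc',
    padicValRat.mul hs0 (pow_ne_zero 2 ht'), padicValRat.pow (W.torsionOrder : ℚ),
    padicValRat.of_nat, padicValRat.of_nat]
  push_cast
  ring

/-- `L(W,1) = s · Ω(W)` with `r_an = 0` forces `s ≠ 0` (modularity `hmod`: `L(W,1) ≠ 0` iff
`ord_{s=1} L(W,s) = 0`, `leadingLCoeff_ne_zero_holds`). [cite: BirchSwinnertonDyer1965] -/
theorem ne_zero_of_entireLFunction_one_eq (hmod : hasEntireLFunction_rat) (hr : W.analyticRank = 0)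
    {s : ℚ} (hs : W.entireLFunction 1 = (s : ℂ) * (W.realPeriodRat : ℂ)) : s ≠ 0 := by
  rintro rfl
  apply W.leadingLCoeff_ne_zero_holds (hmod W)
  rw [leadingLCoeff_eq_of_analyticRank_eq_zero W hr, hs]
  simp

variable [V.IsElliptic]

/-- **The comparison statement in RELATIONS-table columns (analytic rank `0` on both sides).**
With `L(W,1) = s · Ω(W)`, `L(V,1) = s' · Ω(V)` (`s, s' ∈ ℚ`; both nonzero by modularity `hmod`),
`δ_p(W) = δ_p(V)` is EQUIVALENT to the `Ш`-index identity
`ord_p #Ш(W) − ord_p #Ш(V) = (ord_p s − ord_p s') + 2·(ord_p #W(ℚ)_tors − ord_p #V(ℚ)_tors)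
 − (ord_p ∏c(W) − ord_p ∏c(V))`. The three columns on the right are computable per pair (modular
symbols; torsion; Tate's algorithm); the left side is the arithmetic input. Bookkeeping (GZK `hGZK`
for `Reg = 1`). [cite: Miller2011LMS, Def. 1.1] [cite: Darmon2004, Thm. 3.22] -/
theorem defectAgreeAt_iff_shaIndex_rankZero (hGZK : rank_eq_analyticRank_of_analyticRank_le_one)
    (hmod : hasEntireLFunction_rat) (hrW : W.analyticRank = 0) (hrV : V.analyticRank = 0)
    {s s' : ℚ} (hs : W.entireLFunction 1 = (s : ℂ) * (W.realPeriodRat : ℂ))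
    (hs' : V.entireLFunction 1 = (s' : ℂ) * (V.realPeriodRat : ℂ)) :
    DefectAgreeAt W V p ↔
      (padicValNat p W.shaOrder : ℤ) - (padicValNat p V.shaOrder : ℤ) =
        (padicValRat p s - padicValRat p s') +
          2 * ((padicValNat p W.torsionOrder : ℤ) - (padicValNat p V.torsionOrder : ℤ)) -
          ((padicValNat p W.tamagawaProduct : ℤ) - (padicValNat p V.tamagawaProduct : ℤ)) := by
  rw [defectAgreeAt_iff_of_shaAn_eq W V p (shaAn_eq_ratCast_of_rankZero W hGZK hrW hs)
      (shaAn_eq_ratCast_of_rankZero V hGZK hrV hs'),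
    padicValRat_shaAnRat_of_rankZero W p (ne_zero_of_entireLFunction_one_eq W hmod hrW hs)
      W.torsionOrder_pos_holds W.tamagawaProduct_pos_holds,
    padicValRat_shaAnRat_of_rankZero V p (ne_zero_of_entireLFunction_one_eq V hmod hrV hs')
      V.torsionOrder_pos_holds V.tamagawaProduct_pos_holds]
  constructor <;> intro h <;> linarith

/-- **R4's shape, analytic rank `0`: `BSDp W p ↔ BSDp V p` GIVEN the `Ш`-index identity** of
`defectAgreeAt_iff_shaIndex_rankZero` (ord_p of the `L/Ω`-ratio, the torsion ratio and the
Tamagawa ratio against the `Ш`-ratio). Binders: GZK `hGZK`, modularity `hmod`, the two `L`-value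
presentations. Class-agnostic. [cite: Miller2011LMS, Def. 1.1] [cite: Darmon2004, Thm. 3.22] -/
theorem bsdp_iff_bsdp_rankZero_of_shaIndex (hGZK : rank_eq_analyticRank_of_analyticRank_le_one)
    (hmod : hasEntireLFunction_rat) (hrW : W.analyticRank = 0) (hrV : V.analyticRank = 0)
    {s s' : ℚ} (hs : W.entireLFunction 1 = (s : ℂ) * (W.realPeriodRat : ℂ))
    (hs' : V.entireLFunction 1 = (s' : ℂ) * (V.realPeriodRat : ℂ))
    (hidx : (padicValNat p W.shaOrder : ℤ) - (padicValNat p V.shaOrder : ℤ) =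
        (padicValRat p s - padicValRat p s') +
          2 * ((padicValNat p W.torsionOrder : ℤ) - (padicValNat p V.torsionOrder : ℤ)) -
          ((padicValNat p W.tamagawaProduct : ℤ) - (padicValNat p V.tamagawaProduct : ℤ))) :
    BSDp W p ↔ BSDp V p :=
  bsdp_iff_bsdp_of_defectAgreeAt W V p hGZK (by omega) (by omega)
    ((defectAgreeAt_iff_shaIndex_rankZero W V p hGZK hmod hrW hrV hs hs').mpr hidx)

/-- **Necessity in columns**: if `BSD(W,p)` and `BSD(V,p)` both hold (rank `0` both), the `Ш`-index
identity holds — the RELATIONS-table row of a pair of CLOSED pairs always balances. Bookkeeping.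
[cite: Miller2011LMS, Def. 1.1] -/
theorem shaIndex_of_bsdp_of_bsdp_rankZero (hGZK : rank_eq_analyticRank_of_analyticRank_le_one)
    (hmod : hasEntireLFunction_rat) (hrW : W.analyticRank = 0) (hrV : V.analyticRank = 0)
    {s s' : ℚ} (hs : W.entireLFunction 1 = (s : ℂ) * (W.realPeriodRat : ℂ))
    (hs' : V.entireLFunction 1 = (s' : ℂ) * (V.realPeriodRat : ℂ))
    (hW : BSDp W p) (hV : BSDp V p) :
    (padicValNat p W.shaOrder : ℤ) - (padicValNat p V.shaOrder : ℤ) =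
        (padicValRat p s - padicValRat p s') +
          2 * ((padicValNat p W.torsionOrder : ℤ) - (padicValNat p V.torsionOrder : ℤ)) -
          ((padicValNat p W.tamagawaProduct : ℤ) - (padicValNat p V.tamagawaProduct : ℤ)) := by
  haveI : Finite W.sha := (hGZK W (by omega)).2
  haveI : Finite V.sha := (hGZK V (by omega)).2
  exact (defectAgreeAt_iff_shaIndex_rankZero W V p hGZK hmod hrW hrV hs hs').mp
    (defectAgreeAt_of_bsdp_of_bsdp W V p hW hV)

/-- **LOWER half of `W` from a CLOSED `V` and the `Ш`-index INEQUALITY** (rank `0` both):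
`BSDp V p` and `ord_p #Ш(W) − ord_p #Ш(V) ≥ (ord_p s − ord_p s') + 2Δ_tors − Δ_Tam` give
`MissingLowerBoundAt W p`. (Per pair the inequality is what a descent certificate exhibiting enough
independent elements of `Ш(W)[p^∞]` supplies; the file's docstring records why the twist adds
nothing here beyond bookkeeping.) [cite: Miller2011LMS, Def. 1.1] -/
theorem missingLowerBoundAt_of_bsdp_of_shaIndex_ge
    (hGZK : rank_eq_analyticRank_of_analyticRank_le_one)
    (hmod : hasEntireLFunction_rat) (hrW : W.analyticRank = 0) (hrV : V.analyticRank = 0)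
    {s s' : ℚ} (hs : W.entireLFunction 1 = (s : ℂ) * (W.realPeriodRat : ℂ))
    (hs' : V.entireLFunction 1 = (s' : ℂ) * (V.realPeriodRat : ℂ)) (hV : BSDp V p)
    (hge : (padicValRat p s - padicValRat p s') +
          2 * ((padicValNat p W.torsionOrder : ℤ) - (padicValNat p V.torsionOrder : ℤ)) -
          ((padicValNat p W.tamagawaProduct : ℤ) - (padicValNat p V.tamagawaProduct : ℤ)) ≤
        (padicValNat p W.shaOrder : ℤ) - (padicValNat p V.shaOrder : ℤ)) :
    MissingLowerBoundAt W p := by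
  haveI : Finite V.sha := (hGZK V (by omega)).2
  refine missingLowerBoundAt_of_bsdp_of_defect_le W V p hV
    (shaAn_eq_ratCast_of_rankZero W hGZK hrW hs) (shaAn_eq_ratCast_of_rankZero V hGZK hrV hs') ?_
  rw [padicValRat_shaAnRat_of_rankZero W p (ne_zero_of_entireLFunction_one_eq W hmod hrW hs)
      W.torsionOrder_pos_holds W.tamagawaProduct_pos_holds,
    padicValRat_shaAnRat_of_rankZero V p (ne_zero_of_entireLFunction_one_eq V hmod hrV hs')
      V.torsionOrder_pos_holds V.tamagawaProduct_pos_holds]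
  linarith

/-- **UPPER half of `W` from a CLOSED `V` and the reverse `Ш`-index inequality** (rank `0` both).
[cite: Miller2011LMS, Def. 1.1] -/
theorem missingUpperBoundAt_of_bsdp_of_shaIndex_le
    (hGZK : rank_eq_analyticRank_of_analyticRank_le_one)
    (hmod : hasEntireLFunction_rat) (hrW : W.analyticRank = 0) (hrV : V.analyticRank = 0)
    {s s' : ℚ} (hs : W.entireLFunction 1 = (s : ℂ) * (W.realPeriodRat : ℂ))
    (hs' : V.entireLFunction 1 = (s' : ℂ) * (V.realPeriodRat : ℂ)) (hV : BSDp V p)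
    (hle : (padicValNat p W.shaOrder : ℤ) - (padicValNat p V.shaOrder : ℤ) ≤
        (padicValRat p s - padicValRat p s') +
          2 * ((padicValNat p W.torsionOrder : ℤ) - (padicValNat p V.torsionOrder : ℤ)) -
          ((padicValNat p W.tamagawaProduct : ℤ) - (padicValNat p V.tamagawaProduct : ℤ))) :
    MissingUpperBoundAt W p := by
  haveI : Finite V.sha := (hGZK V (by omega)).2
  refine missingUpperBoundAt_of_bsdp_of_defect_ge W V p hV
    (shaAn_eq_ratCast_of_rankZero W hGZK hrW hs) (shaAn_eq_ratCast_of_rankZero V hGZK hrV hs') ?_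
  rw [padicValRat_shaAnRat_of_rankZero W p (ne_zero_of_entireLFunction_one_eq W hmod hrW hs)
      W.torsionOrder_pos_holds W.tamagawaProduct_pos_holds,
    padicValRat_shaAnRat_of_rankZero V p (ne_zero_of_entireLFunction_one_eq V hmod hrV hs')
      V.torsionOrder_pos_holds V.tamagawaProduct_pos_holds]
  linarith

end RankZero

end TwistComparison

end Summit.BirchSwinnertonDyer.Rank1Residual.Additive

end
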